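import Mathlib
import Literature.Analysis.FluidPDE.VectorCalculus
import Literature.Analysis.FluidPDE.VectorCalculusProofs
import Summits.NavierStokesRegularity.NavierStokesRegularity.Theorems.SlicedKelvinDefs
import Summits.NavierStokesRegularity.NavierStokesRegularity.Theorems.SlicedKelvinPlanarFluxAPrioriSqrtReg
import Summits.NavierStokesRegularity.NavierStokesRegularity.Theorems.SlicedKelvinPlanarFluxAPrioriPlaneChart
import Summits.NavierStokesRegularity.NavierStokesRegularity.Theorems.SlicedKelvinPlanarFluxAPrioriFoldPointwise
import Summits.NavierStokesRegularity.NavierStokesRegularity.Theorems.SlicedKelvinPlanarFluxAPrioriFoldDecay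

/-!
# Crux `SlicedKelvin.PlanarFluxAPriori` (stmt-NavierStokesRegularity-15600), line `registered`
  (skeleton `Cruxes/PlanarFluxAPriori/Lines/birth.lean`, rev 2): STUB `stub_epsFoldLaw`

Lands `--supports stmt-NavierStokesRegularity-15600` the registered stub `stub_epsFoldLaw`: the
frame-covariant ε-FOLD LAW `Theorems.SlicedKelvin.EpsFoldLawOn ν ε c R v` (route support item
`FoldLawEps`, stmt-NavierStokesRegularity-15606, in a general frame `R` and under polynomial
decay) for every smooth divergence-free `v : ℝ³ → ℝ³` with `(1 + ‖x‖)³ ‖Dᵏv(x)‖ ≤ C`, `k ≤ 3`,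
every height `c`, real `ν` and `ε > 0`. With `n = R e₂`, `eᵢ = R eᵢ`, `ω = curl v`, `f = ⟪ω, n⟫`,
`F(s) = √(s² + ε²)` (`F' = s/F`, `F'' = ε²/F³`), `w = νΔω − (v·∇)ω + (ω·∇)v` and the plane chart
`P y = R (y₀, y₁, c)` of `R{x₂ = c}`:
`∫ F'(f)⟪w,n⟫ ∘ P = ν ∫ ∂ₙ∂ₙ(F∘f) ∘ P − ν ∫ F''(f) |∇f|² ∘ P`
`  − ∫ ⟪v,n⟫ F''(f) (⟪ω,e₀⟫ ∂₀f + ⟪ω,e₁⟫ ∂₁f) ∘ P − ε² ∫ ∂ₙ⟪v,n⟫ / F(f) ∘ P`.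

Proof. The pointwise law `foldLaw_pointwise` (helper file `…FoldPointwise`) writes the integrand
on the left as the four integrands on the right plus an in-plane divergence `∂₀X₀ + ∂₁X₁`,
`Xᵢ = ν ∂ᵢ(F∘f) − ⟪v,eᵢ⟫ F(f) + F'(f) ⟪v,n⟫ ⟪ω,eᵢ⟫`. All eight functions involved (the four
integrands, `X₀, X₁, ∂₀X₀, ∂₁X₁`) are continuous and decay like `(1 + ‖x‖)⁻³` (bookkeeping of
`…FoldDecay`: `|F'| ≤ 1`, `F'' ≤ ε⁻¹`, `1/F ≤ 1/ε`, `F(f) ≤ sup |f| + ε`, while `v, Dv, ω, Dω,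
f, Df, D²f` decay — the decay of `v` itself, `k = 0`, enters through the transport flux
`⟪v,eᵢ⟫ F(f)`), hence are integrable on the plane (`integrable_comp_planeChart_of_decay`:
`‖P y‖ ≥ ‖y‖` and `∫_{ℝ²} (1 + ‖y‖)⁻³ < ∞`); the divergence terms integrate to zero
(`integral_fderiv_planeChart_eq_zero`: `∂ᵢXᵢ ∘ P = ∂_{yᵢ}(Xᵢ ∘ P)` and whole-space integration by
parts on `ℝ²`), and the plane integral splits by linearity (`integral_sub_sub_sub_add_add`).
In the proof, `n, e₀, e₁, Ω` are `set` abbreviations of `R e₂, R e₀, R e₁, curl v`.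
-/

noncomputable section

namespace Summit.NavierStokesRegularity.NavierStokesRegularity.Theorems.SlicedKelvinPlanarFluxAPriori

-- Problem = summit for this single-conjunct summit: the duplicate namespace component is deliberate.
set_option linter.dupNamespace false

open MeasureTheory
open Literature.Analysis.FluidPDE
open scoped InnerProductSpace RealInnerProductSpace ContDiff

/-- Linearity bookkeeping for the plane integral of the pointwise fold law: if `a, b, c, d, e, f`
are integrable and the two divergence terms `e, f` integrate to zero, then
`∫ (a − b − c − d + e + f) = ∫ a − ∫ b − ∫ c − ∫ d`. -/
theorem integral_sub_sub_sub_add_add {α : Type*} [MeasurableSpace α] {μ : Measure α}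
    {a b c d e f : α → ℝ} (ha : Integrable a μ) (hb : Integrable b μ) (hc : Integrable c μ)
    (hd : Integrable d μ) (he : Integrable e μ) (hf : Integrable f μ)
    (he0 : ∫ x, e x ∂μ = 0) (hf0 : ∫ x, f x ∂μ = 0) :
    ∫ x, (a x - b x - c x - d x + e x + f x) ∂μ =
      (∫ x, a x ∂μ) - (∫ x, b x ∂μ) - (∫ x, c x ∂μ) - ∫ x, d x ∂μ := by
  have h2 : Integrable (fun x => a x - b x) μ := ha.sub hb
  have h3 : Integrable (fun x => a x - b x - c x) μ := h2.sub hc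
  have h4 : Integrable (fun x => a x - b x - c x - d x) μ := h3.sub hd
  have h5 : Integrable (fun x => a x - b x - c x - d x + e x) μ := h4.add he
  rw [integral_add h5 hf, integral_add h4 he, he0, hf0, add_zero, add_zero, integral_sub h3 hd,
    integral_sub h2 hc, integral_sub ha hb]

/-- **STUB `stub_epsFoldLaw`** of the birth skeleton of `SlicedKelvin.PlanarFluxAPriori`
(registered signature, verbatim): the frame-covariant ε-fold law
`Theorems.SlicedKelvin.EpsFoldLawOn ν ε c R v` for every smooth divergence-free field `v` on `ℝ³`
whose derivatives of orders `≤ 3` decay like `(1 + ‖x‖)⁻³`, every frame `R`, height `c`, real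
`ν` and `ε > 0`. Integrate `foldLaw_pointwise` over the plane through the chart
`y ↦ R (y₀, y₁, c)`: the eight functions involved are continuous with cubic decay, hence
integrable on the plane, and the in-plane divergence integrates to zero. -/
theorem stub_epsFoldLaw : ∀ (ν ε c : ℝ), 0 < ε → ∀ (R : EuclideanSpace ℝ (Fin 3) ≃ₗᵢ[ℝ] EuclideanSpace ℝ (Fin 3)) (v : EuclideanSpace ℝ (Fin 3) → EuclideanSpace ℝ (Fin 3)), ContDiff ℝ (⊤ : ℕ∞) v → (∃ C : ℝ, ∀ (x : EuclideanSpace ℝ (Fin 3)) (k : ℕ), k ≤ 3 → (1 + ‖x‖) ^ 3 * ‖iteratedFDeriv ℝ k v x‖ ≤ C) → Literature.Analysis.FluidPDE.VectorCalculus.IsDivFree v → Summit.NavierStokesRegularity.NavierStokesRegularity.Theorems.SlicedKelvin.EpsFoldLawOn ν ε c R v := by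
  intro ν ε c hε R v hv hC hdiv
  obtain ⟨C, hC⟩ := hC
  dsimp only
      [Summit.NavierStokesRegularity.NavierStokesRegularity.Theorems.SlicedKelvin.EpsFoldLawOn]
  /- 0. the pointwise law under the integral; abbreviations -/
  have hpt := fun y : EuclideanSpace ℝ (Fin 2) =>
    foldLaw_pointwise ν ε hε R v hv hdiv (R (WithLp.toLp 2 ![y 0, y 1, c]))
  rw [integral_congr_ae (Filter.Eventually.of_forall hpt)]
  clear hpt
  set n : EuclideanSpace ℝ (Fin 3) := R (EuclideanSpace.single 2 1)
  set e₀ : EuclideanSpace ℝ (Fin 3) := R (EuclideanSpace.single 0 1)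
  set e₁ : EuclideanSpace ℝ (Fin 3) := R (EuclideanSpace.single 1 1)
  set Ω : EuclideanSpace ℝ (Fin 3) → EuclideanSpace ℝ (Fin 3) := curl v
  /- 1. smoothness, continuity and differentiability of the atoms -/
  have hv2 : ContDiff ℝ 2 v := contDiff_infty.1 hv 2
  have hΩ : ContDiff ℝ ∞ Ω := SlicedKelvinPlanarFluxAPriori.contDiff_curl hv
  have hΩ2 : ContDiff ℝ 2 Ω := contDiff_infty.1 hΩ 2
  have hf : ContDiff ℝ ∞ (fun s => ⟪Ω s, n⟫) := contDiff_inner_curl hv _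
  have hf2 : ContDiff ℝ 2 (fun s => ⟪Ω s, n⟫) := contDiff_infty.1 hf 2
  have hG : ContDiff ℝ ∞ (fun s => Real.sqrt (⟪Ω s, n⟫ ^ 2 + ε ^ 2)) :=
    contDiff_sqrtReg_inner_curl hv hε _
  have hF1 : ContDiff ℝ ∞ (fun s => ⟪Ω s, n⟫ / Real.sqrt (⟪Ω s, n⟫ ^ 2 + ε ^ 2)) :=
      (contDiff_div_sqrtReg hε).comp hf
  have hvd : ∀ z, DifferentiableAt ℝ v z := fun z => hv2.differentiable (by norm_num) z
  have hfd : ∀ z, DifferentiableAt ℝ (fun s => ⟪Ω s, n⟫) z := fun z =>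
    hf2.differentiable (by norm_num) z
  have hvD : Differentiable ℝ v := hv.differentiable (by simp)
  have hΩD : Differentiable ℝ Ω := hΩ.differentiable (by simp)
  have hDfD : Differentiable ℝ (fderiv ℝ (fun s => ⟪Ω s, n⟫)) :=
    (hf.fderiv_right (m := ∞) le_rfl).differentiable (by simp)
  have cv : Continuous v := hv.continuous
  have cDv : Continuous (fderiv ℝ v) := hv.continuous_fderiv (by simp)
  have cΩ : Continuous Ω := hΩ.continuous
  have cDΩ : Continuous (fderiv ℝ Ω) := hΩ.continuous_fderiv (by simp)
  have cDf : Continuous (fderiv ℝ (fun s => ⟪Ω s, n⟫)) := hf.continuous_fderiv (by simp)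
  have cD2f : Continuous (fderiv ℝ (fderiv ℝ (fun s => ⟪Ω s, n⟫))) :=
    (hf.fderiv_right (m := ∞) le_rfl).continuous_fderiv (by simp)
  have cG : Continuous (fun s => Real.sqrt (⟪Ω s, n⟫ ^ 2 + ε ^ 2)) := hG.continuous
  have cF1 : Continuous (fun s => ⟪Ω s, n⟫ / Real.sqrt (⟪Ω s, n⟫ ^ 2 + ε ^ 2)) := hF1.continuous
  have cF2 : Continuous (fun s => ε ^ 2 / Real.sqrt (⟪Ω s, n⟫ ^ 2 + ε ^ 2) ^ 3) :=
    continuous_const.div (cG.pow 3) fun x => by positivity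
  have cDvN : Continuous (fun x => fderiv ℝ (fun s => ⟪v s, n⟫) x n) :=
    ((contDiff_inner_const hv n).continuous_fderiv (by simp)).clm_apply continuous_const
  -- derivatives of `F ∘ f`, the second normal derivative, the divergence terms (pointwise)
  have hGE : ∀ (e z : EuclideanSpace ℝ (Fin 3)), fderiv ℝ (fun s => Real.sqrt (⟪Ω s, n⟫ ^ 2 +
      ε ^ 2)) z e =
      ⟪Ω z, n⟫ / Real.sqrt (⟪Ω z, n⟫ ^ 2 + ε ^ 2) * fderiv ℝ (fun s => ⟪Ω s, n⟫) z e :=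
    fun e z => fderiv_sqrtReg_comp_apply hε (hfd z) e
  have hT1 := fun x => fderiv_fderiv_sqrtReg_comp_apply hε hf2 x n n
  have hDX0 := fun x => fderiv_foldFlux_apply hε ν hv2 hΩ2 n e₀ e₀ x
  have hDX1 := fun x => fderiv_foldFlux_apply hε ν hv2 hΩ2 n e₁ e₁ x
  /- 2. decay of the atoms, bounded factors -/
  have hn : ‖n‖ = 1 := norm_frame R 2
  have he0 : ‖e₀‖ = 1 := norm_frame R 0
  have he1 : ‖e₁‖ = 1 := norm_frame R 1
  obtain ⟨dv0, dv1, -⟩ := decay_zero_one_two (g := v) (K := C) fun x k hk => hC x k (by omega)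
  obtain ⟨dΩ0, dΩ1, -⟩ := decay_zero_one_two fun x k hk => decay_iteratedFDeriv_curl hv hC x k hk
  obtain ⟨df0, df1, df2⟩ :=
    decay_zero_one_two fun x k hk => decay_iteratedFDeriv_inner_curl hv hC n x k hk
  have BF1 := bdd_div_sqrtReg_comp ε (fun s => ⟪Ω s, n⟫)
  have BF2 := bdd_sq_div_sqrtReg_comp_cube hε (fun s => ⟪Ω s, n⟫)
  have BG := bdd_sqrtReg_comp hε.le (bdd_of_decay ⟨_, df0⟩)
  beta_reduce at BF1 BF2 BG
  /- 3. the eight integrands are continuous with cubic decay, hence integrable on the plane -/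
  -- `∂ₙ∂ₙ(F∘f) = F''(f) (∂ₙf)² + F'(f) ∂ₙ∂ₙf`
  have cT1 : Continuous fun x => fderiv ℝ (fun t => fderiv ℝ (fun s => Real.sqrt (⟪Ω s, n⟫ ^ 2 +
      ε ^ 2)) t n) x n := by
    simp only [hT1]
    fun_prop
  have dT1 : ∃ K : ℝ, ∀ x, (1 + ‖x‖) ^ 3 * ‖fderiv ℝ (fun t => fderiv ℝ (fun s => Real.sqrt
      (⟪Ω s, n⟫ ^ 2 + ε ^ 2)) t n) x n‖ ≤ K := by
    simp only [hT1]
    exact decay_add (decay_mul_bdd (bdd_mul_decay BF2 (decay_fderiv_apply_of_decay df1 hn))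
      (bdd_of_decay (decay_fderiv_apply_of_decay df1 hn)))
      (bdd_mul_decay BF1 (decay_fderiv_fderiv_apply_of_decay df2 hn hn))
  obtain ⟨KT1, hKT1⟩ := dT1
  have IT1 := integrable_comp_planeChart_of_decay R c cT1 hKT1
  -- `F''(f) |∇f|²`
  have cT2 : Continuous fun x => ε ^ 2 / Real.sqrt (⟪Ω x, n⟫ ^ 2 + ε ^ 2) ^ 3 * (fderiv ℝ (fun
      s => ⟪Ω s, n⟫) x e₀ ^ 2 + fderiv ℝ (fun s => ⟪Ω s, n⟫) x e₁ ^ 2 + fderiv ℝ (fun s => ⟪Ω s, n⟫)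
      x n ^ 2) := by
    fun_prop (disch := (intro x; positivity))
  obtain ⟨KT2, hKT2⟩ := bdd_mul_decay BF2 (decay_add (decay_add
    (decay_sq (decay_fderiv_apply_of_decay df1 he0)) (decay_sq (decay_fderiv_apply_of_decay df1
        he1)))
    (decay_sq (decay_fderiv_apply_of_decay df1 hn)))
  have IT2 := integrable_comp_planeChart_of_decay R c cT2 hKT2
  -- `⟪v,n⟫ F''(f) (ω₀ ∂₀f + ω₁ ∂₁f)`
  have cT3 : Continuous fun x => ⟪v x, n⟫ * (ε ^ 2 / Real.sqrt (⟪Ω x, n⟫ ^ 2 + ε ^ 2) ^ 3) *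
      (⟪Ω x, e₀⟫ * fderiv ℝ (fun s => ⟪Ω s, n⟫) x e₀ + ⟪Ω x, e₁⟫ * fderiv ℝ (fun s => ⟪Ω s, n⟫) x
      e₁) := by
    fun_prop (disch := (intro x; positivity))
  obtain ⟨KT3, hKT3⟩ := decay_mul_bdd (decay_mul_bdd (decay_inner_of_decay dv0 hn) BF2)
    (bdd_add (bdd_mul (bdd_of_decay (decay_inner_of_decay dΩ0 he0))
      (bdd_of_decay (decay_fderiv_apply_of_decay df1 he0)))
      (bdd_mul (bdd_of_decay (decay_inner_of_decay dΩ0 he1))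
      (bdd_of_decay (decay_fderiv_apply_of_decay df1 he1))))
  have IT3 := integrable_comp_planeChart_of_decay R c cT3 hKT3
  -- `∂ₙ⟪v,n⟫ / F(f)`
  have cT4 : Continuous fun x => fderiv ℝ (fun s => ⟪v s, n⟫) x n / Real.sqrt (⟪Ω x, n⟫ ^ 2 + ε ^ 2)
      :=
    cDvN.div cG fun x => (sqrt_sq_add_sq_pos hε _).ne'
  have hle : ∀ x, ‖fderiv ℝ (fun s => ⟪v s, n⟫) x n‖ ≤ ‖fderiv ℝ v x‖ := fun x => by
    rw [fderiv_inner_const_apply (hvd x)]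
    exact norm_inner_apply_le hn hn _
  obtain ⟨KT4, hKT4⟩ := decay_div_of_le (decay_of_norm_le hle ⟨C, dv1⟩) hε
    fun x => le_sqrt_sq_add_sq hε.le ⟪Ω x, n⟫
  have IT4 := integrable_comp_planeChart_of_decay R c cT4 hKT4
  -- flux component `X = ν ∂ₑ(F∘f) − ⟪v,e⟫ F(f) + F'(f) ⟪v,n⟫ ⟪ω,e⟫` along `e = e₀`
  have cX0 : Continuous fun x => ν * fderiv ℝ (fun s => Real.sqrt (⟪Ω s, n⟫ ^ 2 + ε ^ 2)) x e₀ -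
      ⟪v x, e₀⟫ * Real.sqrt (⟪Ω x, n⟫ ^ 2 + ε ^ 2) + ⟪Ω x, n⟫ / Real.sqrt (⟪Ω x, n⟫ ^ 2 + ε ^ 2) *
      ⟪v x, n⟫ * ⟪Ω x, e₀⟫ := by
    simp only [hGE]
    fun_prop (disch := (intro x; positivity))
  have dX0 : ∃ K : ℝ, ∀ x, (1 + ‖x‖) ^ 3 * ‖ν * fderiv ℝ (fun s => Real.sqrt (⟪Ω s, n⟫ ^ 2 + ε ^ 2))
      x e₀ - ⟪v x, e₀⟫ * Real.sqrt (⟪Ω x, n⟫ ^ 2 + ε ^ 2) + ⟪Ω x, n⟫ / Real.sqrt (⟪Ω x, n⟫ ^ 2 +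
      ε ^ 2) * ⟪v x, n⟫ * ⟪Ω x, e₀⟫‖ ≤ K := by
    simp only [hGE]
    exact decay_add (decay_sub (bdd_mul_decay (bdd_const ν)
      (bdd_mul_decay BF1 (decay_fderiv_apply_of_decay df1 he0)))
      (decay_mul_bdd (decay_inner_of_decay dv0 he0) BG))
      (bdd_mul_decay (bdd_mul BF1 (bdd_of_decay (decay_inner_of_decay dv0 hn)))
        (decay_inner_of_decay dΩ0 he0))
  obtain ⟨KX0, hKX0⟩ := dX0
  have IX0 := integrable_comp_planeChart_of_decay R c cX0 hKX0
  -- flux component `X = ν ∂ₑ(F∘f) − ⟪v,e⟫ F(f) + F'(f) ⟪v,n⟫ ⟪ω,e⟫` along `e = e₁`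
  have cX1 : Continuous fun x => ν * fderiv ℝ (fun s => Real.sqrt (⟪Ω s, n⟫ ^ 2 + ε ^ 2)) x e₁ -
      ⟪v x, e₁⟫ * Real.sqrt (⟪Ω x, n⟫ ^ 2 + ε ^ 2) + ⟪Ω x, n⟫ / Real.sqrt (⟪Ω x, n⟫ ^ 2 + ε ^ 2) *
      ⟪v x, n⟫ * ⟪Ω x, e₁⟫ := by
    simp only [hGE]
    fun_prop (disch := (intro x; positivity))
  have dX1 : ∃ K : ℝ, ∀ x, (1 + ‖x‖) ^ 3 * ‖ν * fderiv ℝ (fun s => Real.sqrt (⟪Ω s, n⟫ ^ 2 + ε ^ 2))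
      x e₁ - ⟪v x, e₁⟫ * Real.sqrt (⟪Ω x, n⟫ ^ 2 + ε ^ 2) + ⟪Ω x, n⟫ / Real.sqrt (⟪Ω x, n⟫ ^ 2 +
      ε ^ 2) * ⟪v x, n⟫ * ⟪Ω x, e₁⟫‖ ≤ K := by
    simp only [hGE]
    exact decay_add (decay_sub (bdd_mul_decay (bdd_const ν)
      (bdd_mul_decay BF1 (decay_fderiv_apply_of_decay df1 he1)))
      (decay_mul_bdd (decay_inner_of_decay dv0 he1) BG))
      (bdd_mul_decay (bdd_mul BF1 (bdd_of_decay (decay_inner_of_decay dv0 hn)))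
        (decay_inner_of_decay dΩ0 he1))
  obtain ⟨KX1, hKX1⟩ := dX1
  have IX1 := integrable_comp_planeChart_of_decay R c cX1 hKX1
  -- in-plane divergence term `∂ₑX` along `e = e₀` (Leibniz expansion `fderiv_foldFlux_apply`)
  have cDX0 : Continuous fun x => fderiv ℝ (fun z => ν * fderiv ℝ (fun s => Real.sqrt (⟪Ω s, n⟫ ^ 2
      + ε ^ 2)) z e₀ - ⟪v z, e₀⟫ * Real.sqrt (⟪Ω z, n⟫ ^ 2 + ε ^ 2) + ⟪Ω z, n⟫ / Real.sqrt
      (⟪Ω z, n⟫ ^ 2 + ε ^ 2) * ⟪v z, n⟫ * ⟪Ω z, e₀⟫) x e₀ := by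
    simp only [hDX0]
    fun_prop (disch := (intro x; positivity))
  have dDX0 : ∃ K : ℝ, ∀ x, (1 + ‖x‖) ^ 3 * ‖fderiv ℝ (fun z => ν * fderiv ℝ (fun s => Real.sqrt
      (⟪Ω s, n⟫ ^ 2 + ε ^ 2)) z e₀ - ⟪v z, e₀⟫ * Real.sqrt (⟪Ω z, n⟫ ^ 2 + ε ^ 2) + ⟪Ω z, n⟫ /
      Real.sqrt (⟪Ω z, n⟫ ^ 2 + ε ^ 2) * ⟪v z, n⟫ * ⟪Ω z, e₀⟫) x e₀‖ ≤ K := by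
    simp only [hDX0]
    exact decay_add (decay_sub (bdd_mul_decay (bdd_const ν) (decay_add
      (decay_mul_bdd (bdd_mul_decay BF2 (decay_inner_fderiv_of_decay dΩ1 hn he0))
        (bdd_of_decay (decay_inner_fderiv_of_decay dΩ1 hn he0)))
      (bdd_mul_decay BF1 (decay_fderiv_fderiv_apply_of_decay df2 he0 he0))))
      (decay_add (decay_mul_bdd (decay_inner_fderiv_of_decay dv1 he0 he0) BG)
        (decay_mul_bdd (decay_inner_of_decay dv0 he0) (bdd_mul BF1
          (bdd_of_decay (decay_inner_fderiv_of_decay dΩ1 hn he0))))))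
      (decay_add (decay_add
        (decay_mul_bdd (decay_mul_bdd (bdd_mul_decay BF2 (decay_inner_fderiv_of_decay dΩ1 hn he0))
          (bdd_of_decay (decay_inner_of_decay dv0 hn))) (bdd_of_decay (decay_inner_of_decay dΩ0
              he0)))
        (decay_mul_bdd (bdd_mul_decay BF1 (decay_inner_fderiv_of_decay dv1 hn he0))
          (bdd_of_decay (decay_inner_of_decay dΩ0 he0))))
        (decay_mul_bdd (bdd_mul_decay BF1 (decay_inner_of_decay dv0 hn))
          (bdd_of_decay (decay_inner_fderiv_of_decay dΩ1 he0 he0))))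
  obtain ⟨KDX0, hKDX0⟩ := dDX0
  have IDX0 := integrable_comp_planeChart_of_decay R c cDX0 hKDX0
  -- in-plane divergence term `∂ₑX` along `e = e₁` (Leibniz expansion `fderiv_foldFlux_apply`)
  have cDX1 : Continuous fun x => fderiv ℝ (fun z => ν * fderiv ℝ (fun s => Real.sqrt (⟪Ω s, n⟫ ^ 2
      + ε ^ 2)) z e₁ - ⟪v z, e₁⟫ * Real.sqrt (⟪Ω z, n⟫ ^ 2 + ε ^ 2) + ⟪Ω z, n⟫ / Real.sqrt
      (⟪Ω z, n⟫ ^ 2 + ε ^ 2) * ⟪v z, n⟫ * ⟪Ω z, e₁⟫) x e₁ := by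
    simp only [hDX1]
    fun_prop (disch := (intro x; positivity))
  have dDX1 : ∃ K : ℝ, ∀ x, (1 + ‖x‖) ^ 3 * ‖fderiv ℝ (fun z => ν * fderiv ℝ (fun s => Real.sqrt
      (⟪Ω s, n⟫ ^ 2 + ε ^ 2)) z e₁ - ⟪v z, e₁⟫ * Real.sqrt (⟪Ω z, n⟫ ^ 2 + ε ^ 2) + ⟪Ω z, n⟫ /
      Real.sqrt (⟪Ω z, n⟫ ^ 2 + ε ^ 2) * ⟪v z, n⟫ * ⟪Ω z, e₁⟫) x e₁‖ ≤ K := by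
    simp only [hDX1]
    exact decay_add (decay_sub (bdd_mul_decay (bdd_const ν) (decay_add
      (decay_mul_bdd (bdd_mul_decay BF2 (decay_inner_fderiv_of_decay dΩ1 hn he1))
        (bdd_of_decay (decay_inner_fderiv_of_decay dΩ1 hn he1)))
      (bdd_mul_decay BF1 (decay_fderiv_fderiv_apply_of_decay df2 he1 he1))))
      (decay_add (decay_mul_bdd (decay_inner_fderiv_of_decay dv1 he1 he1) BG)
        (decay_mul_bdd (decay_inner_of_decay dv0 he1) (bdd_mul BF1
          (bdd_of_decay (decay_inner_fderiv_of_decay dΩ1 hn he1))))))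
      (decay_add (decay_add
        (decay_mul_bdd (decay_mul_bdd (bdd_mul_decay BF2 (decay_inner_fderiv_of_decay dΩ1 hn he1))
          (bdd_of_decay (decay_inner_of_decay dv0 hn))) (bdd_of_decay (decay_inner_of_decay dΩ0
              he1)))
        (decay_mul_bdd (bdd_mul_decay BF1 (decay_inner_fderiv_of_decay dv1 hn he1))
          (bdd_of_decay (decay_inner_of_decay dΩ0 he1))))
        (decay_mul_bdd (bdd_mul_decay BF1 (decay_inner_of_decay dv0 hn))
          (bdd_of_decay (decay_inner_fderiv_of_decay dΩ1 he1 he1))))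
  obtain ⟨KDX1, hKDX1⟩ := dDX1
  have IDX1 := integrable_comp_planeChart_of_decay R c cDX1 hKDX1
  /- 4. the in-plane divergence integrates to zero over the plane -/
  have hXd0 : Differentiable ℝ (fun z => ν * fderiv ℝ (fun s => Real.sqrt (⟪Ω s, n⟫ ^ 2 + ε ^ 2)) z
      e₀ - ⟪v z, e₀⟫ * Real.sqrt (⟪Ω z, n⟫ ^ 2 + ε ^ 2) + ⟪Ω z, n⟫ / Real.sqrt (⟪Ω z, n⟫ ^ 2 +
      ε ^ 2) * ⟪v z, n⟫ * ⟪Ω z, e₀⟫) :=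
    (((contDiff_const.mul ((hG.fderiv_right (m := ∞) le_rfl).clm_apply contDiff_const)).sub
      ((contDiff_inner_const hv _).mul hG)).add
      ((hF1.mul (contDiff_inner_const hv _)).mul (contDiff_inner_const hΩ _))).differentiable
      (by simp)
  have hXd1 : Differentiable ℝ (fun z => ν * fderiv ℝ (fun s => Real.sqrt (⟪Ω s, n⟫ ^ 2 + ε ^ 2)) z
      e₁ - ⟪v z, e₁⟫ * Real.sqrt (⟪Ω z, n⟫ ^ 2 + ε ^ 2) + ⟪Ω z, n⟫ / Real.sqrt (⟪Ω z, n⟫ ^ 2 +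
      ε ^ 2) * ⟪v z, n⟫ * ⟪Ω z, e₁⟫) :=
    (((contDiff_const.mul ((hG.fderiv_right (m := ∞) le_rfl).clm_apply contDiff_const)).sub
      ((contDiff_inner_const hv _).mul hG)).add
      ((hF1.mul (contDiff_inner_const hv _)).mul (contDiff_inner_const hΩ _))).differentiable
      (by simp)
  have hDiv0 : ∫ y : EuclideanSpace ℝ (Fin 2), fderiv ℝ _ (R (WithLp.toLp 2 ![y 0, y 1, c])) e₀ =
      (0 : ℝ) :=
    integral_fderiv_planeChart_eq_zero R c 0 _ hXd0 IX0 IDX0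
  have hDiv1 : ∫ y : EuclideanSpace ℝ (Fin 2), fderiv ℝ _ (R (WithLp.toLp 2 ![y 0, y 1, c])) e₁ =
      (0 : ℝ) :=
    integral_fderiv_planeChart_eq_zero R c 1 _ hXd1 IX1 IDX1
  /- 5. split the plane integral -/
  rw [integral_sub_sub_sub_add_add (IT1.const_mul ν) (IT2.const_mul ν) IT3 (IT4.const_mul (ε ^ 2))
    IDX0 IDX1 hDiv0 hDiv1, integral_const_mul, integral_const_mul, integral_const_mul]

end Summit.NavierStokesRegularity.NavierStokesRegularity.Theorems.SlicedKelvinPlanarFluxAPriori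

end
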